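import Mathlib
import Summits.ValiantsHypothesis.ValiantsHypothesis.Theorems.LiouvilleSarnakAlignedTypeICharactersMod2nOneStub
import Summits.ValiantsHypothesis.ValiantsHypothesis.Theorems.LiouvilleSarnakAlignedTypeICharactersMod2nTopLevels
import HarnessLib

/-!
# Route LiouvilleSarnak — support `AlignedTypeI` (stmt-ValiantsHypothesis-21040), line `characters_mod_2n`:
# the single stub `KMTVariance` in character-free currency, and its comparison with the crux

Companion of `…CharactersMod2nOneStub.lean` (the line has one stub of content, `KMTVariance`; the second registered
stub follows from it).  Here that stub is rewritten WITHOUT characters and WITHOUT main term: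

* §1 `KMTVariance` ⟺ the `ℓ²` statement `Σ_{u ∈ (ℤ/2^k)ˣ} (Σ_{b<2^n} λ(u + 2^k b))² ≤ ε 2^k 4^n` for
  `k₀ ≤ k ≤ n`, `n ≥ n₀` (`kmtVariance_iff_unitSqSum`).  Forward: termwise
  `A(u)² ≤ 2|A(u) − χ(u)W/φ|² + 2|χ(u)W/φ|²`, summed `≤ 2V + 2‖W‖²/φ`, and the one-character main term
  `W = Σ λχ̄` is always negligible for `λ` and `2`-power moduli (dichotomy of `…KMTOnly.lean`: `χ² ≠ 1` forced by the
  variance, `χ² = 1` by Green's range).  Backward: take the trivial character as KMT character.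
* §2 `KMTVariance` ⟺ the `ℓ¹` statement `Σ_{u ∈ (ℤ/2^k)ˣ} |Σ_{b<2^n} λ(u + 2^k b)| ≤ ε 2^(n+k)` at all levels
  `k₀ ≤ k ≤ n` (`kmtVariance_iff_unitAbsSum`; `ℓ¹ ↔ ℓ²` by Cauchy–Schwarz one way and the trivial bound
  `|A(u)| ≤ 2^n` the other).  By `alignedTypeI_iff_topLevels` (`…TopLevels.lean`) the CRUX `AlignedTypeI` is the same
  `ℓ¹` statement at the TOP levels `k = n - j` (each fixed `j ≥ 0`) only; `alignedTypeI_of_unitAbsSum` records the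
  implication all levels ⇒ top levels ⇒ crux.  So the registered stub over-asks exactly in the RANGE of levels
  (`k₀ ≤ k ≤ n` against `n - O_ε(1) ≤ k ≤ n`), not in strength per level: per level it is precisely
  `ℓ¹`-equidistribution of `λ` among the odd classes to modulus `2^k` inside `[1, 2^(n+k)]`.

HONEST FRAMING.  Pure bookkeeping between the line's registered propositions; nothing cite-grade is discharged, no
stub is closed by name, `AlignedTypeI` is NOT closed (its residual is unchanged: Klurman–Mangerel–Teräväinen 2023
Thm 1.3 for `λ` and `2`-power moduli `≍ √x`), and nothing here bears on `VP ≠ VNP` (NOT proved).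
-/

set_option linter.dupNamespace false

noncomputable section

namespace Summit.ValiantsHypothesis.ValiantsHypothesis.Theorems.LiouvilleSarnak.AlignedTypeI.CharactersModTwoN

open ArithmeticFunction Finset
open scoped BigOperators

/-! ## §1 The stub in character-free `ℓ²` currency -/

/-- **`KMTVariance` ⇒ character-free `ℓ²` equidistribution**: for every `ε > 0`, for `n ≥ n₀` and
`k₀ ≤ k ≤ n`, `Σ_{u ∈ (ℤ/2^k)ˣ} (Σ_{b<2^n} λ(u + 2^k b))² ≤ ε 2^k 4^n`.  Termwise
`A(u)² ≤ 2|A(u) − χ(u)W/φ|² + 2|χ(u)W/φ|²` with `W = Σ λ χ̄` the KMT main term; summing, `≤ 2V + 2‖W‖²/φ`, and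
`‖W‖ ≤ δ 2^(n+k)` by the dichotomy of `…KMTOnly.lean` (`χ² ≠ 1`: `twisted_le_of_variance_of_sq_ne_one`; `χ² = 1`:
`twisted_le_of_sq_eq_one`), so `≤ 2η 2^k 4^n + 4δ² 2^k 4^n` (`η = δ² = ε/6`). [folklore] -/
theorem unitSqSum_of_kmtVariance (hK : KMTVariance) :
    ∀ ε : ℝ, 0 < ε → ∃ k₀ n₀ : ℕ, ∀ n ≥ n₀, ∀ k : ℕ, k₀ ≤ k → k ≤ n →
      ∑ u : (ZMod (2 ^ k))ˣ,
        (∑ b : Fin (2 ^ n), ((liouville ((u : ZMod (2 ^ k)).val + 2 ^ k * (b : ℕ)) : ℤ) : ℝ)) ^ 2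
          ≤ ε * 2 ^ k * 4 ^ n := by
  intro ε hε
  set η : ℝ := ε / 6 with hη
  have hη0 : 0 < η := by positivity
  set δ : ℝ := Real.sqrt η with hδ
  have hδ0 : 0 < δ := Real.sqrt_pos.mpr hη0
  have hδsq : δ ^ 2 = η := Real.sq_sqrt hη0.le
  obtain ⟨k₀, n₁, hV⟩ := hK η hη0
  obtain ⟨n₂, hR⟩ := twisted_le_of_sq_eq_one hδ0
  refine ⟨max k₀ 1, max n₁ n₂, fun n hn k hk hkn => ?_⟩
  have hk1 : 1 ≤ k := le_trans (le_max_right _ _) hk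
  have hn1 : n₁ ≤ n := le_trans (le_max_left _ _) hn
  have hn2 : n₂ ≤ n := le_trans (le_max_right _ _) hn
  obtain ⟨χ, hχ⟩ := hV n hn1 k (le_trans (le_max_left _ _) hk) hkn
  haveI : NeZero (2 ^ k) := ⟨pow_ne_zero _ two_ne_zero⟩
  set W : ℂ := ∑ m : Fin (2 ^ (n + k)), ((liouville ((m : ℕ) + 1) : ℤ) : ℂ) *
      star (χ (((m : ℕ) + 1 : ℕ) : ZMod (2 ^ k))) with hW
  -- the main term is small: dichotomy
  have hWle : ‖W‖ ≤ δ * 2 ^ (n + k) := by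
    rw [hW, norm_twistedSum_star]
    by_cases hsq : χ ^ 2 = 1
    · exact hR n hn2 k hk1 χ hsq
    · refine twisted_le_of_variance_of_sq_ne_one hk1 hδ0.le χ hsq ?_
      rw [hδsq]
      exact hχ
  have hφ := totient_two_pow_cast hk1
  have hφ0 : (0 : ℝ) < Nat.totient (2 ^ k) := by rw [hφ]; positivity
  -- termwise inequality, summed
  have hsum : ∑ u : (ZMod (2 ^ k))ˣ,
      (∑ b : Fin (2 ^ n), ((liouville ((u : ZMod (2 ^ k)).val + 2 ^ k * (b : ℕ)) : ℤ) : ℝ)) ^ 2 ≤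
        2 * ∑ u : (ZMod (2 ^ k))ˣ,
          ‖(∑ b : Fin (2 ^ n), ((liouville ((u : ZMod (2 ^ k)).val + 2 ^ k * (b : ℕ)) : ℤ) : ℂ))
            - χ (u : ZMod (2 ^ k)) / (Nat.totient (2 ^ k) : ℂ) * W‖ ^ 2 +
        2 * ∑ u : (ZMod (2 ^ k))ˣ, ‖χ (u : ZMod (2 ^ k)) / (Nat.totient (2 ^ k) : ℂ) * W‖ ^ 2 := by
    rw [Finset.mul_sum, Finset.mul_sum, ← Finset.sum_add_distrib]
    refine Finset.sum_le_sum fun u _ => ?_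
    rw [← sq_abs, ← norm_classSum_cast]
    -- `‖a‖² ≤ 2‖a - c‖² + 2‖c‖²`
    have key : ∀ a c : ℂ, ‖a‖ ^ 2 ≤ 2 * ‖a - c‖ ^ 2 + 2 * ‖c‖ ^ 2 := fun a c => by
      have h : ‖a‖ ≤ ‖a - c‖ + ‖c‖ := by
        calc ‖a‖ = ‖(a - c) + c‖ := by rw [sub_add_cancel]
          _ ≤ ‖a - c‖ + ‖c‖ := norm_add_le _ _
      nlinarith [norm_nonneg (a - c), norm_nonneg c, norm_nonneg a, sq_nonneg (‖a - c‖ - ‖c‖)]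
    exact key _ _
  rw [sum_units_norm_mainTerm_sq χ W] at hsum
  have h2k : (2 : ℝ) ^ k = 2 * 2 ^ (k - 1) := by rw [← pow_succ', Nat.sub_add_cancel hk1]
  have h4 : (4 : ℝ) ^ n = (2 ^ n) ^ 2 := by rw [← pow_mul, mul_comm, pow_mul]; norm_num
  have hW2 : ‖W‖ ^ 2 / (Nat.totient (2 ^ k) : ℝ) ≤ 2 * η * 2 ^ k * 4 ^ n := by
    rw [div_le_iff₀ hφ0, hφ, h2k, h4]
    have h1 : ‖W‖ ^ 2 ≤ (δ * 2 ^ (n + k)) ^ 2 := pow_le_pow_left₀ (norm_nonneg _) hWle 2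
    rw [mul_pow, hδsq, pow_add, h2k] at h1
    nlinarith [h1]
  calc _ ≤ _ := hsum
    _ ≤ 2 * (η * 2 ^ k * 4 ^ n) + 2 * (2 * η * 2 ^ k * 4 ^ n) := by gcongr
    _ = ε * 2 ^ k * 4 ^ n := by rw [hη]; ring

/-- **Character-free `ℓ²` equidistribution ⇒ `KMTVariance`**, with the TRIVIAL character as KMT character: the
variance around `χ = 1` is `≤ 2 Σ_u A(u)² + 2‖W₁‖²/φ` with `W₁ = Σ_{m ≤ x, m odd} λ(m)`, and `‖W₁‖ ≤ δ 2^(n+k)`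
unconditionally (`twisted_le_of_sq_eq_one`, `1² = 1`). [folklore] -/
theorem kmtVariance_of_unitSqSum
    (h : ∀ ε : ℝ, 0 < ε → ∃ k₀ n₀ : ℕ, ∀ n ≥ n₀, ∀ k : ℕ, k₀ ≤ k → k ≤ n →
      ∑ u : (ZMod (2 ^ k))ˣ,
        (∑ b : Fin (2 ^ n), ((liouville ((u : ZMod (2 ^ k)).val + 2 ^ k * (b : ℕ)) : ℤ) : ℝ)) ^ 2
          ≤ ε * 2 ^ k * 4 ^ n) :
    KMTVariance := by
  intro ε hε
  set δ : ℝ := Real.sqrt (ε / 8) with hδ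
  have hδ0 : 0 < δ := Real.sqrt_pos.mpr (by positivity)
  have hδsq : δ ^ 2 = ε / 8 := Real.sq_sqrt (by positivity)
  obtain ⟨k₀, n₁, hS⟩ := h (ε / 4) (by positivity)
  obtain ⟨n₂, hR⟩ := twisted_le_of_sq_eq_one hδ0
  refine ⟨max k₀ 1, max n₁ n₂, fun n hn k hk hkn => ⟨1, ?_⟩⟩
  have hk1 : 1 ≤ k := le_trans (le_max_right _ _) hk
  have hn1 : n₁ ≤ n := le_trans (le_max_left _ _) hn
  have hn2 : n₂ ≤ n := le_trans (le_max_right _ _) hn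
  have hSk := hS n hn1 k (le_trans (le_max_left _ _) hk) hkn
  haveI : NeZero (2 ^ k) := ⟨pow_ne_zero _ two_ne_zero⟩
  set W : ℂ := ∑ m : Fin (2 ^ (n + k)), ((liouville ((m : ℕ) + 1) : ℤ) : ℂ) *
      star ((1 : DirichletCharacter ℂ (2 ^ k)) (((m : ℕ) + 1 : ℕ) : ZMod (2 ^ k))) with hW
  have hWle : ‖W‖ ≤ δ * 2 ^ (n + k) := by
    rw [hW, norm_twistedSum_star]
    exact hR n hn2 k hk1 1 (one_pow 2)
  have hφ := totient_two_pow_cast hk1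
  have hφ0 : (0 : ℝ) < Nat.totient (2 ^ k) := by rw [hφ]; positivity
  have hsum : ∑ u : (ZMod (2 ^ k))ˣ,
      ‖(∑ b : Fin (2 ^ n), ((liouville ((u : ZMod (2 ^ k)).val + 2 ^ k * (b : ℕ)) : ℤ) : ℂ))
        - (1 : DirichletCharacter ℂ (2 ^ k)) (u : ZMod (2 ^ k)) / (Nat.totient (2 ^ k) : ℂ) * W‖ ^ 2 ≤
        2 * ∑ u : (ZMod (2 ^ k))ˣ,
          (∑ b : Fin (2 ^ n), ((liouville ((u : ZMod (2 ^ k)).val + 2 ^ k * (b : ℕ)) : ℤ) : ℝ)) ^ 2 +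
        2 * ∑ u : (ZMod (2 ^ k))ˣ,
          ‖(1 : DirichletCharacter ℂ (2 ^ k)) (u : ZMod (2 ^ k)) / (Nat.totient (2 ^ k) : ℂ) * W‖ ^ 2 := by
    rw [Finset.mul_sum, Finset.mul_sum, ← Finset.sum_add_distrib]
    refine Finset.sum_le_sum fun u _ => ?_
    -- `‖a - c‖² ≤ 2‖a‖² + 2‖c‖²`
    have key : ∀ a c : ℂ, ‖a - c‖ ^ 2 ≤ 2 * ‖a‖ ^ 2 + 2 * ‖c‖ ^ 2 := fun a c => by
      have h : ‖a - c‖ ≤ ‖a‖ + ‖c‖ := norm_sub_le _ _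
      nlinarith [norm_nonneg (a - c), norm_nonneg c, norm_nonneg a, sq_nonneg (‖a‖ - ‖c‖)]
    refine (key _ _).trans (le_of_eq ?_)
    rw [norm_classSum_cast, sq_abs]
  rw [sum_units_norm_mainTerm_sq 1 W] at hsum
  have h2k : (2 : ℝ) ^ k = 2 * 2 ^ (k - 1) := by rw [← pow_succ', Nat.sub_add_cancel hk1]
  have h4 : (4 : ℝ) ^ n = (2 ^ n) ^ 2 := by rw [← pow_mul, mul_comm, pow_mul]; norm_num
  have hW2 : ‖W‖ ^ 2 / (Nat.totient (2 ^ k) : ℝ) ≤ ε / 4 * 2 ^ k * 4 ^ n := by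
    rw [div_le_iff₀ hφ0, hφ, h2k, h4]
    have h1 : ‖W‖ ^ 2 ≤ (δ * 2 ^ (n + k)) ^ 2 := pow_le_pow_left₀ (norm_nonneg _) hWle 2
    rw [mul_pow, hδsq, pow_add, h2k] at h1
    nlinarith [h1]
  calc _ ≤ _ := hsum
    _ ≤ 2 * (ε / 4 * 2 ^ k * 4 ^ n) + 2 * (ε / 4 * 2 ^ k * 4 ^ n) := by gcongr
    _ = ε * 2 ^ k * 4 ^ n := by ring

/-- **`KMTVariance` ⟺ character-free `ℓ²` equidistribution of `λ` over the odd classes mod `2^k` along `b < 2^n`,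
at all levels `k₀ ≤ k ≤ n`** (no character, no main term). [folklore] -/
theorem kmtVariance_iff_unitSqSum :
    KMTVariance ↔
      ∀ ε : ℝ, 0 < ε → ∃ k₀ n₀ : ℕ, ∀ n ≥ n₀, ∀ k : ℕ, k₀ ≤ k → k ≤ n →
        ∑ u : (ZMod (2 ^ k))ˣ,
          (∑ b : Fin (2 ^ n), ((liouville ((u : ZMod (2 ^ k)).val + 2 ^ k * (b : ℕ)) : ℤ) : ℝ)) ^ 2
            ≤ ε * 2 ^ k * 4 ^ n :=
  ⟨unitSqSum_of_kmtVariance, kmtVariance_of_unitSqSum⟩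

/-! ## §2 The stub in character-free `ℓ¹` currency; comparison with the crux -/

/-- `ℓ² ⇒ ℓ¹` (Cauchy–Schwarz over the `φ(2^k) ≤ 2^k` units): if `Σ_u A(u)² ≤ ε² 2^k 4^n` then
`Σ_u |A(u)| ≤ ε 2^(n+k)`. [folklore] -/
theorem unitAbsSum_of_unitSqSum
    (h : ∀ ε : ℝ, 0 < ε → ∃ k₀ n₀ : ℕ, ∀ n ≥ n₀, ∀ k : ℕ, k₀ ≤ k → k ≤ n →
      ∑ u : (ZMod (2 ^ k))ˣ,
        (∑ b : Fin (2 ^ n), ((liouville ((u : ZMod (2 ^ k)).val + 2 ^ k * (b : ℕ)) : ℤ) : ℝ)) ^ 2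
          ≤ ε * 2 ^ k * 4 ^ n) :
    ∀ ε : ℝ, 0 < ε → ∃ k₀ n₀ : ℕ, ∀ n ≥ n₀, ∀ k : ℕ, k₀ ≤ k → k ≤ n →
      ∑ u : (ZMod (2 ^ k))ˣ,
        |∑ b : Fin (2 ^ n), ((liouville ((u : ZMod (2 ^ k)).val + 2 ^ k * (b : ℕ)) : ℤ) : ℝ)|
          ≤ ε * 2 ^ (n + k) := by
  intro ε hε
  obtain ⟨k₀, n₀, hS⟩ := h (ε ^ 2) (by positivity)
  refine ⟨k₀, n₀, fun n hn k hk hkn => ?_⟩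
  have hSk := hS n hn k hk hkn
  haveI : NeZero (2 ^ k) := ⟨pow_ne_zero _ two_ne_zero⟩
  -- Cauchy–Schwarz with the constant function `1`
  have hCS := Finset.sum_mul_sq_le_sq_mul_sq (Finset.univ : Finset (ZMod (2 ^ k))ˣ)
    (fun u => |∑ b : Fin (2 ^ n), ((liouville ((u : ZMod (2 ^ k)).val + 2 ^ k * (b : ℕ)) : ℤ) : ℝ)|)
    (fun _ => (1 : ℝ))
  simp only [mul_one, one_pow, sq_abs, Finset.sum_const, Finset.card_univ, nsmul_eq_mul, mul_one] at hCS
  have hcard : (Fintype.card (ZMod (2 ^ k))ˣ : ℝ) ≤ 2 ^ k := by exact_mod_cast card_units_le k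
  have hB : (∑ u : (ZMod (2 ^ k))ˣ,
      |∑ b : Fin (2 ^ n), ((liouville ((u : ZMod (2 ^ k)).val + 2 ^ k * (b : ℕ)) : ℤ) : ℝ)|) ^ 2 ≤
        (ε * 2 ^ (n + k)) ^ 2 := by
    refine hCS.trans ?_
    have h0 : (0 : ℝ) ≤ ∑ u : (ZMod (2 ^ k))ˣ,
        (∑ b : Fin (2 ^ n), ((liouville ((u : ZMod (2 ^ k)).val + 2 ^ k * (b : ℕ)) : ℤ) : ℝ)) ^ 2 :=
      Finset.sum_nonneg fun _ _ => by positivity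
    calc _ ≤ (ε ^ 2 * 2 ^ k * 4 ^ n) * 2 ^ k := mul_le_mul hSk hcard (by positivity) (by positivity)
      _ = (ε * 2 ^ (n + k)) ^ 2 := by
        rw [show (4 : ℝ) ^ n = (2 ^ n) ^ 2 by rw [← pow_mul, mul_comm, pow_mul]; norm_num, pow_add]
        ring
  exact (pow_le_pow_iff_left₀ (Finset.sum_nonneg fun _ _ => abs_nonneg _) (by positivity) two_ne_zero).mp hB

/-- `ℓ¹ ⇒ ℓ²` (every class sum is `≤ 2^n` in absolute value): if `Σ_u |A(u)| ≤ ε 2^(n+k)` then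
`Σ_u A(u)² ≤ 2^n Σ_u |A(u)| ≤ ε 2^k 4^n`. [folklore] -/
theorem unitSqSum_of_unitAbsSum
    (h : ∀ ε : ℝ, 0 < ε → ∃ k₀ n₀ : ℕ, ∀ n ≥ n₀, ∀ k : ℕ, k₀ ≤ k → k ≤ n →
      ∑ u : (ZMod (2 ^ k))ˣ,
        |∑ b : Fin (2 ^ n), ((liouville ((u : ZMod (2 ^ k)).val + 2 ^ k * (b : ℕ)) : ℤ) : ℝ)|
          ≤ ε * 2 ^ (n + k)) :
    ∀ ε : ℝ, 0 < ε → ∃ k₀ n₀ : ℕ, ∀ n ≥ n₀, ∀ k : ℕ, k₀ ≤ k → k ≤ n →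
      ∑ u : (ZMod (2 ^ k))ˣ,
        (∑ b : Fin (2 ^ n), ((liouville ((u : ZMod (2 ^ k)).val + 2 ^ k * (b : ℕ)) : ℤ) : ℝ)) ^ 2
          ≤ ε * 2 ^ k * 4 ^ n := by
  intro ε hε
  obtain ⟨k₀, n₀, hS⟩ := h ε hε
  refine ⟨k₀, n₀, fun n hn k hk hkn => ?_⟩
  have hSk := hS n hn k hk hkn
  have hterm : ∀ u : (ZMod (2 ^ k))ˣ,
      (∑ b : Fin (2 ^ n), ((liouville ((u : ZMod (2 ^ k)).val + 2 ^ k * (b : ℕ)) : ℤ) : ℝ)) ^ 2 ≤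
        2 ^ n * |∑ b : Fin (2 ^ n), ((liouville ((u : ZMod (2 ^ k)).val + 2 ^ k * (b : ℕ)) : ℤ) : ℝ)| := by
    intro u
    rw [← sq_abs, sq]
    exact mul_le_mul_of_nonneg_right (abs_classSum_cast_le n k u) (abs_nonneg _)
  calc _ ≤ ∑ u : (ZMod (2 ^ k))ˣ,
        2 ^ n * |∑ b : Fin (2 ^ n), ((liouville ((u : ZMod (2 ^ k)).val + 2 ^ k * (b : ℕ)) : ℤ) : ℝ)| :=
        Finset.sum_le_sum fun u _ => hterm u
    _ = 2 ^ n * ∑ u : (ZMod (2 ^ k))ˣ,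
        |∑ b : Fin (2 ^ n), ((liouville ((u : ZMod (2 ^ k)).val + 2 ^ k * (b : ℕ)) : ℤ) : ℝ)| := by
        rw [Finset.mul_sum]
    _ ≤ 2 ^ n * (ε * 2 ^ (n + k)) := by gcongr
    _ = ε * 2 ^ k * 4 ^ n := by
        rw [pow_add, show (4 : ℝ) ^ n = (2 ^ n) ^ 2 by rw [← pow_mul, mul_comm, pow_mul]; norm_num]
        ring

/-- **`KMTVariance` ⟺ character-free `ℓ¹` equidistribution at all levels `k₀ ≤ k ≤ n`**:
`Σ_{u ∈ (ℤ/2^k)ˣ} |Σ_{b<2^n} λ(u + 2^k b)| ≤ ε 2^(n+k)`.  Compare `alignedTypeI_iff_topLevels`: the crux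
`AlignedTypeI` is the same statement at the top levels `k = n - j` (each fixed `j ≥ 0`) only. [folklore] -/
theorem kmtVariance_iff_unitAbsSum :
    KMTVariance ↔
      ∀ ε : ℝ, 0 < ε → ∃ k₀ n₀ : ℕ, ∀ n ≥ n₀, ∀ k : ℕ, k₀ ≤ k → k ≤ n →
        ∑ u : (ZMod (2 ^ k))ˣ,
          |∑ b : Fin (2 ^ n), ((liouville ((u : ZMod (2 ^ k)).val + 2 ^ k * (b : ℕ)) : ℤ) : ℝ)|
            ≤ ε * 2 ^ (n + k) :=
  ⟨fun h => unitAbsSum_of_unitSqSum (unitSqSum_of_kmtVariance h),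
    fun h => kmtVariance_of_unitSqSum (unitSqSum_of_unitAbsSum h)⟩

/-- **All levels ⇒ top levels**: the character-free `ℓ¹` statement at all levels `k₀ ≤ k ≤ n` implies the crux
`AlignedTypeI` (through `alignedTypeI_iff_topLevels`: at co-depth `j`, the level `k = n - j` is `≥ k₀` once
`n ≥ k₀ + j`, and `ε 2^(n+k) ≤ ε 4^n`).  With `kmtVariance_iff_unitAbsSum` this is a second route to
`alignedTypeI_of_KMTVariance`. [folklore] -/
theorem alignedTypeI_of_unitAbsSum
    (h : ∀ ε : ℝ, 0 < ε → ∃ k₀ n₀ : ℕ, ∀ n ≥ n₀, ∀ k : ℕ, k₀ ≤ k → k ≤ n →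
      ∑ u : (ZMod (2 ^ k))ˣ,
        |∑ b : Fin (2 ^ n), ((liouville ((u : ZMod (2 ^ k)).val + 2 ^ k * (b : ℕ)) : ℤ) : ℝ)|
          ≤ ε * 2 ^ (n + k)) :
    Summit.ValiantsHypothesis.ValiantsHypothesis.Theses.LiouvilleSarnak.AlignedTypeI := by
  refine alignedTypeI_iff_topLevels.mpr fun j ε hε => ?_
  obtain ⟨k₀, n₀, hS⟩ := h ε hε
  refine ⟨max n₀ (k₀ + j), fun n k hn hnk _ => ?_⟩
  have hn0 : n₀ ≤ n := le_trans (le_max_left _ _) hn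
  have hk0 : k₀ ≤ k := by have := le_trans (le_max_right _ _) hn; omega
  have hkn : k ≤ n := by omega
  refine (hS n hn0 k hk0 hkn).trans ?_
  have h2 : (2 : ℝ) ^ (n + k) ≤ 4 ^ n := by
    rw [show (4 : ℝ) ^ n = 2 ^ (n + n) by rw [← two_mul, pow_mul]; norm_num]
    exact pow_le_pow_right₀ (by norm_num) (by omega)
  exact mul_le_mul_of_nonneg_left h2 hε.le

end Summit.ValiantsHypothesis.ValiantsHypothesis.Theorems.LiouvilleSarnak.AlignedTypeI.CharactersModTwoN
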